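import Literature.AnabelianGeometry.EtaleTheta.Discharge.Sec2OrbitEmbeddingCoeff
import Literature.AnabelianGeometry.EtaleTheta.Discharge.Sec2ThetaOrbitClasses
import Literature.AnabelianGeometry.EtaleTheta.ContH1ConjAction
import HarnessLib

/-!
# [EtTh] Def 2.7 at the §1 model: the root class `η̲̈^Θ` of `ThetaOrbitData.ofEmbedding` is INHABITED
# (non-vacuity of `root_pow` / of the collections `η̲̈^{Θ,l·ℤ×μ₂} ⊇ η̲̈^{Θ,l·ℤ}`)

Mochizuki, *The Étale Theta Function …* [EtTh], Publ. RIMS 45 (2009), §2, Def 2.7, PRIMS PDF p.41 (bib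
key `MochizukiEtTh2009`): "upon restriction to `Ÿ̲̲`, `η̈^Θ` determines `η̲̈^Θ ∈ H¹(Π^tp_{Ÿ̲̲}, l·Δ_Θ)`".

PROOF-ONLY companion (no `def`; seat abc-iut-L2-t2) of `ThetaRootOrbitsOfSetting.lean`. The root classes
of `ofEmbedding` (`OrbitEmbedding.rootClassOf x` = the `l`-th roots on `Π^tp_{Ÿ̲̲}` of representatives of
`x`) could a priori be EMPTY, which would make the interface clause `ThetaOrbitData.root_pow` vacuous.
From abc-iut-L2-t8's field `DoubleUnderline.eta_res` (an `l·Δ_Θ`-valued continuous cocycle on `Π^tp_{Ÿ̲̲}`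
representing `η̈^Θ|_{Ÿ̲̲}`) we show they are not: `rootClassOf_etaDd_nonempty` — the root class of `η̈^Θ`
itself is inhabited (take a representative `f₀` of `η̈^Θ` on `Π^tp_Ÿ`, correct it by the coboundary that
makes its restriction EQUAL to the `l·Δ_Θ`-valued cocycle, transport, and extract `l`-th roots pointwise
through the cyclotome isomorphism `coeffOf`), hence `ofEmbedding_exists_mem_rootLZ_nonempty` /
`…_rootLZMu2_…`: the collections `η̲̈^{Θ,l·ℤ}`, `η̲̈^{Θ,l·ℤ×μ₂}` of `ofEmbedding ε hC hS` contain an inhabited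
class. HONEST FRAMING: [EtTh] is refereed; no side is taken on [IUTchIII] Cor 3.12; nothing beyond the
displayed statements is claimed.
-/

noncomputable section

namespace Literature.AnabelianGeometry.EtaleTheta

open Literature.AnabelianGeometry.SemiGraphs ThetaCovers
open scoped IsMulCommutative

universe u

namespace ThetaSetting.EtaleThetaData.DoubleUnderline.OrbitEmbedding

variable {p : ℕ} [Fact p.Prime] {D : ThetaSetting p} {E : D.EtaleThetaData} {l : ℕ}
  {C : E.DoubleUnderline l} {T : TemperedCoverData.{u} l} (ε : C.OrbitEmbedding T)

/-- An element of `Π^tp_{Ÿ̲̲}` of `T` pulls back to `Π^tp_Ÿ ∩ Π^tp_{X̲̲}`. [cite: MochizukiEtTh2009, Def 2.7 p.41] -/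
theorem pull_mem_Huu (g : ↥(T.PiYddtp ⊓ T.tp T.PiXuu)) :
    (ε.pull ⟨g, (Subgroup.mem_inf.1 g.2).1⟩ : D.PiTemp) ∈ D.GtpYdd ⊓ C.Huu := by
  obtain ⟨h, hh, hhg⟩ := Subgroup.mem_map.1 (ε.map_Huu.ge (Subgroup.mem_inf.1 g.2).2)
  have heq : (ε.pull ⟨g, (Subgroup.mem_inf.1 g.2).1⟩ : D.PiTemp) = h :=
    ε.injective_ι (by rw [ε.ι_pull]; exact hhg.symm)
  exact Subgroup.mem_inf.2 ⟨(ε.pull _).2, heq ▸ hh⟩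

/-- **The root class of `η̈^Θ` is inhabited**: there is a `top/bot`-valued function `ξ` on `Π^tp_{Ÿ̲̲}` of `T`
and a transported representative `F` of `η̈^Θ` with `ξ^l = F|_{Ÿ̲̲}` — from t8's `l·Δ_Θ`-valued cocycle
`η̲̈^Θ` (`DoubleUnderline.eta_res`). [cite: MochizukiEtTh2009, Def 2.7 p.41] -/
theorem rootClassOf_etaDd_nonempty : (ε.rootClassOf E.etaDd).Nonempty := by
  haveI : ε.bot.Normal := ε.normal_bot
  obtain ⟨e, he⟩ := ε.exists_mulEquiv_coeffOf
  obtain ⟨f, hf, hval, hmk⟩ := C.eta_res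
  obtain ⟨f₀, hf₀⟩ := QuotientGroup.mk_surjective E.etaDd
  -- the restriction of `f₀` and `f` define the same class on `Π^tp_{Ÿ̲̲}`: they differ by a coboundary
  have hres : (QuotientGroup.mk (ContH1.resCocycle D.toTheta D.DeltaTheta
        (inf_le_left : D.GtpYdd ⊓ C.Huu ≤ D.GtpYdd) f₀) : D.H1 (D.GtpYdd ⊓ C.Huu)) =
      QuotientGroup.mk ⟨f, hf⟩ := by
    have h := hmk
    rw [← hf₀] at h
    exact h.symm
  obtain ⟨a, ha⟩ := ContH1.exists_coboundary_of_mk_eq _ _ hres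
  -- correct `f₀` by that coboundary on all of `Π^tp_Ÿ`
  let c : ↥(contCocycles D.toTheta D.DeltaTheta D.GtpYdd) :=
    ⟨fun h : ↥D.GtpYdd => MulAut.conjNormal (D.toTheta (h : D.PiTemp)) a * a⁻¹,
      coboundary_mem_contCocycles a D.GtpYdd⟩
  have hc : c ∈ (contCoboundaries D.toTheta D.DeltaTheta D.GtpYdd).subgroupOf
      (contCocycles D.toTheta D.DeltaTheta D.GtpYdd) :=
    Subgroup.mem_subgroupOf.2 ((mem_contCoboundaries_iff _).2 ⟨a, rfl⟩)
  have hF : ContH1.mk (f₀ * c).1 (f₀ * c).2 = E.etaDd := by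
    show (QuotientGroup.mk (f₀ * c) : D.H1 D.GtpYdd) = E.etaDd
    rw [QuotientGroup.mk_mul, (QuotientGroup.eq_one_iff c).2 hc, mul_one, hf₀]
  -- pointwise: `f = (f₀·∂a)|_{Ÿ̲̲}`
  have hf1 : ∀ k : ↥(D.GtpYdd ⊓ C.Huu), f k = (f₀ * c).1 ⟨k, (Subgroup.mem_inf.1 k.2).1⟩ := fun k => ha k
  -- `l`-th roots of the values of `f`
  choose y hy hyl using hval
  refine ⟨fun g => ε.coeffOf ⟨y ⟨_, ε.pull_mem_Huu g⟩, hy _⟩, ε.transport (f₀ * c).1, ⟨f₀ * c, hF, rfl⟩,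
    fun g => ?_⟩
  have hpow : (⟨y ⟨_, ε.pull_mem_Huu g⟩, hy _⟩ : ↥D.DeltaTheta) ^ l = f ⟨_, ε.pull_mem_Huu g⟩ :=
    Subtype.ext (by rw [SubmonoidClass.coe_pow]; exact hyl _)
  show ε.coeffOf _ ^ l = ε.coeffOf ((f₀ * c).1 (ε.pull ⟨g, (Subgroup.mem_inf.1 g.2).1⟩))
  rw [← he, ← map_pow, hpow, hf1, he]

end ThetaSetting.EtaleThetaData.DoubleUnderline.OrbitEmbedding

namespace ThetaCovers.ThetaOrbitData

variable {p : ℕ} [Fact p.Prime] {D : ThetaSetting p} {E : D.EtaleThetaData} {l : ℕ}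
  {C : E.DoubleUnderline l} {T : TemperedCoverData.{u} l} (ε : C.OrbitEmbedding T)

/-- **`η̲̈^{Θ,l·ℤ}` of `ofEmbedding` contains an inhabited class** (the root class of `η̈^Θ` itself: `σ = 1`
lies in `Π^tp_{X̲̲} ∩ ι⁻¹Π^tp_Ċ`). [cite: MochizukiEtTh2009, Def 2.7 p.41] -/
theorem ofEmbedding_exists_mem_rootLZ_nonempty (hC : D.Compat) (hS : D.Sec2Hyps) :
    ∃ c ∈ (ofEmbedding ε hC hS).rootLZ, c.Nonempty := by
  haveI := hC.GtpYdd_normal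
  refine ⟨ε.rootClassOf (ContH1.conj D.toTheta D.DeltaTheta (1 : D.PiTemp) E.etaDd),
    ⟨1, ⟨C.Huu.one_mem, by show ε.ι 1 ∈ T.PiCdot; rw [map_one]; exact T.PiCdot.one_mem⟩, rfl⟩, ?_⟩
  rw [ContH1.conj_one_apply]
  exact ε.rootClassOf_etaDd_nonempty

/-- **`η̲̈^{Θ,l·ℤ×μ₂}` of `ofEmbedding` contains an inhabited class.** [cite: MochizukiEtTh2009, Def 2.7 p.41] -/
theorem ofEmbedding_exists_mem_rootLZMu2_nonempty (hC : D.Compat) (hS : D.Sec2Hyps) :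
    ∃ c ∈ (ofEmbedding ε hC hS).rootLZMu2, c.Nonempty := by
  obtain ⟨c, hc, hne⟩ := ofEmbedding_exists_mem_rootLZ_nonempty ε hC hS
  exact ⟨c, (ofEmbedding ε hC hS).rootLZ_sub hc, hne⟩

/-- The class collections `η̈^{Θ,·}` of `ofEmbedding` consist of inhabited classes (every cohomology class
has a continuous cocycle representative). [cite: MochizukiEtTh2009, Def 2.7 p.41] -/
theorem ofEmbedding_etaZMu2_member_nonempty (hC : D.Compat) (hS : D.Sec2Hyps)
    {c : Set (↥T.PiYddtp → (ofEmbedding ε hC hS).DeltaTheta)} (hc : c ∈ (ofEmbedding ε hC hS).etaZMu2) :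
    c.Nonempty := by
  obtain ⟨σ, -, rfl⟩ := hc
  exact ε.classOf_nonempty _

end ThetaCovers.ThetaOrbitData

end Literature.AnabelianGeometry.EtaleTheta

end
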